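import Literature.AlgebraicGeometry.HodgeTheory.AlgebraicClassesExteriorProduct
import Literature.AlgebraicGeometry.HodgeTheory.ComplexGysin
import Literature.AlgebraicTopology.SingularHomology.CupProductProofs

/-!
# Crux `NikulinSerreCarrier` · line `neron-severi-intertwiner` · stub `stub_nikulinAnchorFrame` (S1) —
# the graph of the completed similitude is algebraic as soon as the graph of `g^*` is

Helper file (`--supports stmt-HodgeConjecture-14464`) for the field `graphAlg` of the anchor `AnchorFrame`
(skeleton `Cruxes/NikulinSerreCarrier/Lines/neron-severi-intertwiner.lean`): for the completed Nikulin
similitude `Ψ y = G (y − Σ_j ℓ_j(y) N_j) + Σ_j ℓ_j(y) r_j` (`ℓ_j(y) p' = −½ (y ∪ N_j)`; sibling files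
`…AnchorFrameLinearAlgebra`, `…AnchorFrame`), with `G = g^* = β_*π^*` killing the nodal classes
(`g̃^* N_j = 2E_j`, `β_* E_j = 0`, van Geemen–Sarti 2007 §1.6 and Prop. 1.8), one has
`Ψ = G + Σ_j ℓ_j ⊗ r_j`, and the rank-one maps `y ↦ (y ∪ N_j) r_j` are the actions of the exterior
products `fst^* r_j ∪ snd^* N_j` of divisor classes — algebraic classes of codimension `2` on `X ⊗ Y`
(Voisin II, proof of Prop. 9.20; the tree's `cupProduct_map_fst_map_snd_mem_algebraicClasses`) — up to
the fibre integral `fst_*(snd^* p') = c_F · 1_X` (projection formula, the tree's `complexGysin_cup`). So: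

* `corr_divisorProduct` — `fst_*(snd^* y ∪ (fst^* b ∪ snd^* a)) = (s c_F) • b` whenever `y ∪ a = s p'`
  (the `X ⊗ Y` version of `divisorCorrespondence_of_fibreIntegral` of
  `Theorems/NikulinTwinTransportRealMultiplicationDivisorCorrespondences.lean`, which treats `S ⊗ S`);
* `exists_graph_of_formula` — if the graph of `G` is algebraic up to a non-zero scalar (`[γ_G]_* = c_G G`;
  van Geemen–Sarti §2.4: the quotient correspondence is "the class of the codimension two cycle which is
  the image of `X̃` in `X × Y` under `(β, π)`"), the `N_j` and `r_j` are algebraic divisor classes, and the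
  fibre integral is a NON-ZERO multiple of `1`, then the graph of `Ψ` is algebraic up to a non-zero
  scalar: `[γ]_* = Ψ` for `γ = c_G⁻¹ γ_G − (2 c_F)⁻¹ Σ_j fst^* r_j ∪ snd^* N_j` — the shape of the field
  `AnchorFrame.graphAlg` (orientation family `μ` arbitrary with Poincaré duality; every scalar existential,
  as the refuter's Lemma L on orientation twists requires).
-/

noncomputable section

-- the doubled component `HodgeConjecture.HodgeConjecture` is the summit/problem layout (D-0022), not a slip
set_option linter.dupNamespace false

namespace Summit.HodgeConjecture.HodgeConjecture.Theorems.NikulinSerreCarrier.NeronSeveriIntertwiner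

open scoped BigOperators
open CategoryTheory MonoidalCategory SemiCartesianMonoidalCategory
open Literature.AlgebraicGeometry Literature.AlgebraicGeometry.Motives Literature.AlgebraicGeometry.HodgeTheory
open Literature.AlgebraicTopology.SingularHomology

variable {X Y : SchemeOver ℂ}

/-- **Divisor products act as rank-one correspondences.** For smooth projective surfaces `X, Y`, classes
`b ∈ H²(X(ℂ))`, `a ∈ H²(Y(ℂ))`, and the fibre integral `fst_*(snd^* p') = c · 1_X` of a class
`p' ∈ H⁴(Y(ℂ))`, the class `fst^* b ∪ snd^* a ∈ H⁴((X ⊗ Y)(ℂ))` acts by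
`y ↦ fst_*(snd^* y ∪ (fst^* b ∪ snd^* a)) = (s c) • b` whenever `y ∪ a = s p'` (graded commutativity,
associativity and naturality of `∪`, and the projection formula `complexGysin_cup`).
[cite: FultonYoungTableaux1997, Appendix B §B.1 (3) and (6)] [cite: Fulton1998, §16.1] -/
theorem corr_divisorProduct (μ : OrientationFamily) (hμ : μ.HasPoincareDuality)
    (hX : IsSmoothProjective 2 X) (hY : IsSmoothProjective 2 Y) (p' : complexBetti Y (2 * 2)) (c : ℂ)
    (hκ : complexGysin μ (IsSmoothProjective.tensor_holds hX hY) hX (fst X Y)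
        (rfl : 2 * 2 + 2 * 2 = 0 + 2 * (2 + 2)) (complexBetti.map (snd X Y) (2 * 2) p') =
      c • singularCohomology.one ℂ (ComplexPoints X))
    (b : complexBetti X (2 * 1)) (a y : complexBetti Y (2 * 1)) (s : ℂ)
    (hya : cupProduct (rfl : 2 * 1 + 2 * 1 = 2 * 2) y a = s • p') :
    complexGysin μ (IsSmoothProjective.tensor_holds hX hY) hX (fst X Y)
        (rfl : 2 * 1 + 2 * 2 + 2 * 2 = 2 * 1 + 2 * (2 + 2))
        (cupProduct (rfl : 2 * 1 + 2 * 2 = 2 * 1 + 2 * 2) (complexBetti.map (snd X Y) (2 * 1) y)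
          (cupProduct (rfl : 2 * 1 + 2 * 1 = 2 * 2) (complexBetti.map (fst X Y) (2 * 1) b)
            (complexBetti.map (snd X Y) (2 * 1) a))) = (s * c) • b := by
  -- `snd^* y ∪ (fst^* b ∪ snd^* a) = fst^* b ∪ snd^* (y ∪ a) = s • (fst^* b ∪ snd^* p')`
  have hcomm : cupProduct (rfl : 2 * 1 + 2 * 1 = 2 * 2) (complexBetti.map (snd X Y) (2 * 1) y)
      (complexBetti.map (fst X Y) (2 * 1) b) =
      cupProduct (rfl : 2 * 1 + 2 * 1 = 2 * 2) (complexBetti.map (fst X Y) (2 * 1) b)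
        (complexBetti.map (snd X Y) (2 * 1) y) := by
    rw [cupProduct_gradedComm_holds ℂ _ (rfl : 2 * 1 + 2 * 1 = 2 * 2) rfl]
    norm_num
  have hnat : cupProduct (rfl : 2 * 1 + 2 * 1 = 2 * 2) (complexBetti.map (snd X Y) (2 * 1) y)
      (complexBetti.map (snd X Y) (2 * 1) a) = s • complexBetti.map (snd X Y) (2 * 2) p' := by
    rw [complexBetti.map, complexBetti.map, ← cupProduct_map, hya, map_smul]
  have h1 : cupProduct (rfl : 2 * 1 + 2 * 2 = 2 * 1 + 2 * 2) (complexBetti.map (snd X Y) (2 * 1) y)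
      (cupProduct (rfl : 2 * 1 + 2 * 1 = 2 * 2) (complexBetti.map (fst X Y) (2 * 1) b)
        (complexBetti.map (snd X Y) (2 * 1) a)) =
      s • cupProduct (rfl : 2 * 1 + 2 * 2 = 2 * 1 + 2 * 2) (complexBetti.map (fst X Y) (2 * 1) b)
        (complexBetti.map (snd X Y) (2 * 2) p') := by
    rw [← cupProduct_assoc (rfl : 2 * 1 + 2 * 1 = 2 * 2) (rfl : 2 * 1 + 2 * 1 = 2 * 2)
      (rfl : 2 * 2 + 2 * 1 = 2 * 1 + 2 * 2) (rfl : 2 * 1 + 2 * 2 = 2 * 1 + 2 * 2), hcomm,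
      cupProduct_assoc (rfl : 2 * 1 + 2 * 1 = 2 * 2) (rfl : 2 * 1 + 2 * 1 = 2 * 2)
      (rfl : 2 * 2 + 2 * 1 = 2 * 1 + 2 * 2) (rfl : 2 * 1 + 2 * 2 = 2 * 1 + 2 * 2), hnat, map_smul]
  -- projection formula and `fst_* snd^* p' = c · 1`
  have h2 : complexGysin μ (IsSmoothProjective.tensor_holds hX hY) hX (fst X Y)
      (rfl : 2 * 1 + 2 * 2 + 2 * 2 = 2 * 1 + 2 * (2 + 2))
      (cupProduct (rfl : 2 * 1 + 2 * 2 = 2 * 1 + 2 * 2) (complexBetti.map (fst X Y) (2 * 1) b)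
        (complexBetti.map (snd X Y) (2 * 2) p')) = c • b := by
    rw [complexGysin_cup hμ (IsSmoothProjective.tensor_holds hX hY) hX (fst X Y)
      (rfl : 2 * 1 + 2 * 2 = 2 * 1 + 2 * 2) (rfl : 2 * 1 + 2 * 2 + 2 * 2 = 2 * 1 + 2 * (2 + 2))
      (rfl : 2 * 2 + 2 * 2 = 0 + 2 * (2 + 2)) (rfl : 2 * 1 + 0 = 2 * 1), hκ, map_smul, cupProduct_one]
  rw [h1, map_smul, h2, smul_smul]

/-- The exterior product `fst^* b ∪ snd^* a` of algebraic DIVISOR classes is an algebraic class of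
codimension `k = 1 + 1` on `X ⊗ Y` (`cupProduct_map_fst_map_snd_mem_algebraicClasses`, with the degree
bookkeeping `1 + 1 = k` explicit so that the numeral `2` can be used downstream).
[cite: VoisinHodgeII2003, proof of Prop. 9.20] -/
theorem divisorProduct_mem_algebraicClasses (hX : IsSmoothProjective 2 X) (hY : IsSmoothProjective 2 Y)
    {b : complexBetti X (2 * 1)} {a : complexBetti Y (2 * 1)} (hb : b ∈ algebraicClasses X 1)
    (ha : a ∈ algebraicClasses Y 1) {k : ℕ} (hk : 1 + 1 = k) (h : 2 * 1 + 2 * 1 = 2 * k) :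
    cupProduct h (complexBetti.map (fst X Y) (2 * 1) b) (complexBetti.map (snd X Y) (2 * 1) a) ∈
      algebraicClasses (X ⊗ Y) k := by
  subst hk
  exact cupProduct_map_fst_map_snd_mem_algebraicClasses hX hY hb ha

/-- **The graph of the completed similitude is algebraic when the graph of `g^*` is.** Let `X, Y` be smooth
projective surfaces, `p' ∈ H⁴(Y(ℂ))` with NON-ZERO fibre integral `fst_*(snd^* p') = c_F · 1_X`, and let
`Ψ y = G(y − Σ ℓ_j(y) N_j) + Σ ℓ_j(y) r_j` with `ℓ_j(y) p' = −½ (y ∪ N_j)` and `G N_j = 0` (the completed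
Nikulin similitude: `g̃^*N_j = 2E_j`, `β_*E_j = 0`). If the `N_j ∈ H²(Y(ℂ))`, `r_j ∈ H²(X(ℂ))` are algebraic
divisor classes and some algebraic `γ_G ∈ N²H⁴((X ⊗ Y)(ℂ))` acts as `c_G · G`, `c_G ≠ 0`, then
`γ = c_G⁻¹ γ_G − (2c_F)⁻¹ Σ_j fst^* r_j ∪ snd^* N_j` is algebraic and acts as `Ψ`:
`[γ]_* y = fst_*(snd^* y ∪ γ) = Ψ y`. (van Geemen–Sarti §2.4: the quotient correspondence is the class of
`(β, π)(X̃) ⊂ X × Y`; Voisin II Prop. 9.20: products of divisors are algebraic.)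
[cite: VanGeemenSarti2007, §1.6, Prop. 1.8 and §2.4] [cite: VoisinHodgeII2003, proof of Prop. 9.20]
[cite: FultonYoungTableaux1997, Appendix B §B.1 (6)] -/
theorem exists_graph_of_formula (μ : OrientationFamily) (hμ : μ.HasPoincareDuality)
    (hX : IsSmoothProjective 2 X) (hY : IsSmoothProjective 2 Y) (p' : complexBetti Y (2 * 2))
    {N : Fin 8 → complexBetti Y (2 * 1)} {r : Fin 8 → complexBetti X (2 * 1)}
    {G Ψ : complexBetti Y (2 * 1) →ₗ[ℂ] complexBetti X (2 * 1)} {ℓ : Fin 8 → complexBetti Y (2 * 1) →ₗ[ℂ] ℂ}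
    (hℓ : ∀ j y, ℓ j y • p' = -((2 : ℂ)⁻¹ • cupProduct (rfl : 2 * 1 + 2 * 1 = 2 * 2) y (N j)))
    (hΨ : ∀ y, Ψ y = G (y - ∑ j, ℓ j y • N j) + ∑ j, ℓ j y • r j) (hGN : ∀ j, G (N j) = 0)
    (hNalg : ∀ j, N j ∈ algebraicClasses Y 1) (hralg : ∀ j, r j ∈ algebraicClasses X 1)
    (hGalg : ∃ γ ∈ algebraicClasses (X ⊗ Y) 2, ∃ c : ℂ, c ≠ 0 ∧ ∀ y : complexBetti Y (2 * 1),
      complexGysin μ (IsSmoothProjective.tensor_holds hX hY) hX (fst X Y)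
          (rfl : 2 * 1 + 2 * 2 + 2 * 2 = 2 * 1 + 2 * (2 + 2))
          (cupProduct (rfl : 2 * 1 + 2 * 2 = 2 * 1 + 2 * 2) (complexBetti.map (snd X Y) (2 * 1) y) γ) =
        c • G y)
    (hFI : ∃ c : ℂ, c ≠ 0 ∧
      complexGysin μ (IsSmoothProjective.tensor_holds hX hY) hX (fst X Y)
          (rfl : 2 * 2 + 2 * 2 = 0 + 2 * (2 + 2)) (complexBetti.map (snd X Y) (2 * 2) p') =
        c • singularCohomology.one ℂ (ComplexPoints X)) :
    ∃ γ ∈ algebraicClasses (X ⊗ Y) 2, ∃ c : ℂ, c ≠ 0 ∧ ∀ y : complexBetti Y (2 * 1),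
      complexGysin μ (IsSmoothProjective.tensor_holds hX hY) hX (fst X Y)
          (rfl : 2 * 1 + 2 * 2 + 2 * 2 = 2 * 1 + 2 * (2 + 2))
          (cupProduct (rfl : 2 * 1 + 2 * 2 = 2 * 1 + 2 * 2) (complexBetti.map (snd X Y) (2 * 1) y) γ) =
        c • Ψ y := by
  obtain ⟨γG, hγGalg, cG, hcG, hγG⟩ := hGalg
  obtain ⟨cF, hcF, hκ⟩ := hFI
  -- the divisor products `γ_j = fst^* r_j ∪ snd^* N_j`
  set γN : Fin 8 → complexBetti (X ⊗ Y) (2 * 2) := fun j ↦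
    cupProduct (rfl : 2 * 1 + 2 * 1 = 2 * 2) (complexBetti.map (fst X Y) (2 * 1) (r j))
      (complexBetti.map (snd X Y) (2 * 1) (N j)) with hγN
  -- `Ψ = G + Σ ℓ_j ⊗ r_j` since `G N_j = 0`
  have hΨ' : ∀ y, Ψ y = G y + ∑ j, ℓ j y • r j := fun y ↦ by
    rw [hΨ, map_sub, map_sum]
    simp only [map_smul, hGN, smul_zero, Finset.sum_const_zero, sub_zero]
  -- `[γ_j]_* y = (−2 ℓ_j(y) c_F) • r_j`
  have hγNact : ∀ j y, complexGysin μ (IsSmoothProjective.tensor_holds hX hY) hX (fst X Y)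
      (rfl : 2 * 1 + 2 * 2 + 2 * 2 = 2 * 1 + 2 * (2 + 2))
      (cupProduct (rfl : 2 * 1 + 2 * 2 = 2 * 1 + 2 * 2) (complexBetti.map (snd X Y) (2 * 1) y) (γN j)) =
        (-2 * ℓ j y * cF) • r j := by
    intro j y
    refine corr_divisorProduct μ hμ hX hY p' cF hκ (r j) (N j) y (-2 * ℓ j y) ?_
    have h := hℓ j y
    rw [mul_smul, h, smul_neg, smul_smul]
    norm_num
  refine ⟨cG⁻¹ • γG + ∑ j, (-(2 * cF)⁻¹) • γN j,
    Submodule.add_mem _ (Submodule.smul_mem _ _ hγGalg)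
      (Submodule.sum_mem _ fun j _ ↦ Submodule.smul_mem _ _
        (divisorProduct_mem_algebraicClasses hX hY (hralg j) (hNalg j) (rfl : 1 + 1 = 2) _)),
    1, one_ne_zero, fun y ↦ ?_⟩
  rw [one_smul, hΨ' y, map_add, map_add, map_smul, map_smul, hγG y, smul_smul, inv_mul_cancel₀ hcG, one_smul,
    map_sum, map_sum]
  congr 1
  refine Finset.sum_congr rfl fun j _ ↦ ?_
  rw [map_smul, map_smul, hγNact j y, smul_smul]
  congr 1
  field_simp

/-- **Registered stub `stub_anchorGraphOfFormula`** (crux item stmt-HodgeConjecture-14464, line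
`neron-severi-intertwiner`, sub-goal of `stub_nikulinAnchorFrame`, field `AnchorFrame.graphAlg`): the graph of
the completed Nikulin similitude is algebraic up to a non-zero scalar as soon as the graph of the quotient
correspondence `g^*` is and the fibre integral is non-zero — verbatim `exists_graph_of_formula`, with the
registered one-line signature (fully qualified names). [cite: VanGeemenSarti2007, §2.4]
[cite: VoisinHodgeII2003, proof of Prop. 9.20] -/
theorem stub_anchorGraphOfFormula : ∀ {X Y : Literature.AlgebraicGeometry.Motives.SchemeOver ℂ} (μ : Literature.AlgebraicGeometry.HodgeTheory.OrientationFamily), μ.HasPoincareDuality → ∀ (hX : Literature.AlgebraicGeometry.Motives.IsSmoothProjective 2 X) (hY : Literature.AlgebraicGeometry.Motives.IsSmoothProjective 2 Y) (p' : Literature.AlgebraicGeometry.HodgeTheory.complexBetti Y (2 * 2)) (N : Fin 8 → Literature.AlgebraicGeometry.HodgeTheory.complexBetti Y (2 * 1)) (r : Fin 8 → Literature.AlgebraicGeometry.HodgeTheory.complexBetti X (2 * 1)) (G Ψ : Literature.AlgebraicGeometry.HodgeTheory.complexBetti Y (2 * 1) →ₗ[ℂ] Literature.AlgebraicGeometry.HodgeTheory.complexBetti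 X (2 * 1)) (ℓ : Fin 8 → Literature.AlgebraicGeometry.HodgeTheory.complexBetti Y (2 * 1) →ₗ[ℂ] ℂ), (∀ j y, ℓ j y • p' = -((2 : ℂ)⁻¹ • Literature.AlgebraicTopology.SingularHomology.cupProduct (rfl : 2 * 1 + 2 * 1 = 2 * 2) y (N j))) → (∀ y, Ψ y = G (y - ∑ j, ℓ j y • N j) + ∑ j, ℓ j y • r j) → (∀ j, G (N j) = 0) → (∀ j, N j ∈ Literature.AlgebraicGeometry.HodgeTheory.algebraicClasses Y 1) → (∀ j, r j ∈ Literature.AlgebraicGeometry.HodgeTheory.algebraicClasses X 1) → (∃ γ ∈ Literature.AlgebraicGeometry.HodgeTheory.algebraicClasses (CategoryTheory.MonoidalCategoryStruct.tensorObj X Y) 2, ∃ c : ℂ, c ≠ 0 ∧ ∀ y : Literature.AlgebraicGeometry.HodgeTheory.complexBetti Y (2 * 1), Literature.AlgebraicGeometry.HodgeTheory.complexGysin μ (Literature.AlgebraicGeometry.Motives.IsSmoothProjective.tensor_holds hX hY) hX (CategoryTheory.SemiCartesianMonoidalCategory.fst X Y) (rfl : 2 * 1 + 2 * 2 + 2 *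 2 = 2 * 1 + 2 * (2 + 2)) (Literature.AlgebraicTopology.SingularHomology.cupProduct (rfl : 2 * 1 + 2 * 2 = 2 * 1 + 2 * 2) (Literature.AlgebraicGeometry.HodgeTheory.complexBetti.map (CategoryTheory.SemiCartesianMonoidalCategory.snd X Y) (2 * 1) y) γ) = c • G y) → (∃ c : ℂ, c ≠ 0 ∧ Literature.AlgebraicGeometry.HodgeTheory.complexGysin μ (Literature.AlgebraicGeometry.Motives.IsSmoothProjective.tensor_holds hX hY) hX (CategoryTheory.SemiCartesianMonoidalCategory.fst X Y) (rfl : 2 * 2 + 2 * 2 = 0 + 2 * (2 + 2)) (Literature.AlgebraicGeometry.HodgeTheory.complexBetti.map (CategoryTheory.SemiCartesianMonoidalCategory.snd X Y) (2 * 2) p') = c • Literature.AlgebraicTopology.SingularHomology.singularCohomology.one ℂ (Literature.AlgebraicGeometry.Motives.ComplexPoints X)) → ∃ γ ∈ Literature.AlgebraicGeometry.HodgeTheory.algebraicClasses (CategoryTheory.MonoidalCategoryStruct.tensorObj X Y) 2, ∃ c : ℂ, c ≠ 0 ∧ ∀ y : Literature.AlgebraicGeometry.HodgeTheory.complexBetti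 Y (2 * 1), Literature.AlgebraicGeometry.HodgeTheory.complexGysin μ (Literature.AlgebraicGeometry.Motives.IsSmoothProjective.tensor_holds hX hY) hX (CategoryTheory.SemiCartesianMonoidalCategory.fst X Y) (rfl : 2 * 1 + 2 * 2 + 2 * 2 = 2 * 1 + 2 * (2 + 2)) (Literature.AlgebraicTopology.SingularHomology.cupProduct (rfl : 2 * 1 + 2 * 2 = 2 * 1 + 2 * 2) (Literature.AlgebraicGeometry.HodgeTheory.complexBetti.map (CategoryTheory.SemiCartesianMonoidalCategory.snd X Y) (2 * 1) y) γ) = c • Ψ y :=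
  fun μ hμ hX hY p' _ _ _ _ _ hℓ hΨ hGN hNalg hralg hGalg hFI ↦
    exists_graph_of_formula μ hμ hX hY p' hℓ hΨ hGN hNalg hralg hGalg hFI

end Summit.HodgeConjecture.HodgeConjecture.Theorems.NikulinSerreCarrier.NeronSeveriIntertwiner

end
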